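import Mathlib
import Summits.KontsevichZagierPeriods.KontsevichZagierPeriods.Theorems.InverseLandauTateFamilyKernelIsotopyTwo

/-!
# `TateFamilyKernel` — the FOLD class of vanishing Tate fibres is a relation class
# (line `Sketch`, stub `stub_foldClass`)

Crux `TateFamilyKernel` (stmt-KontsevichZagierPeriods-9130, route `InverseLandau`), line `Sketch`.
Data (dimension `2`, variables `X 0 = w₀`, `X 1 = w₁`, `X 2 = ϖ` of `ℚ[w₀, w₁, ϖ]`, and
`X 0 = y₀`, `X 1 = y₁`, `X 2 = ϖ` for the target square): a polynomial `c(w₀, w₁, ϖ)` vanishing on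
both faces `w₁ = 0` and `w₁ = 1` (stated as divisibilities `X 1 ∣ c`, `(1 - X 1) ∣ c`), a rational
function `h = B/E ∈ ℚ(y₀, y₁, ϖ)` and a real-algebraic `ϖ₀` such that `E(w₀, s·c(w, ϖ₀), ϖ₀) ≠ 0`
for `w ∈ [0,1]²`, `s ∈ [0,1]`. Conclusion (`stub_foldClass`): every tame cube representation of the
FOLD ELEMENT `h(w₀, c(w, ϖ₀), ϖ₀) · ∂_{w₁} c(w, ϖ₀)` is a KZ relation.

Proof. The fold element is the pull-back `Φ^*(h dy₀ ∧ dy₁)` under the face-compatible polynomial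
self-map `Φ(w) = (w₀, c(w))` of the square, of degree `0` on the `w₁`-direction (both faces
`w₁ ∈ {0, 1}` go to the edge `y₁ = 0`). The straight-line isotopy `Φ_s(w) = (w₀, s·c(w))`,
`s ∈ [0,1]`, from the degenerate map `Φ₀ = (w₀, 0)` (Jacobian `0`) to `Φ₁ = Φ` is again
face-compatible, so the transport theorem `stub_isotopyTwo` (rule (2) along a polynomial isotopy is
an `m = 1` Ayoub certificate) applies with `φ₁ = X 0`, `φ₂ = X 2 * c(X 0, X 1, X 3)` in
`ℚ[w₀, w₁, s, ϖ]`, edge constants `c₁₀ = 0`, `c₁₁ = 1`, `c₂₀ = c₂₁ = 0`: its Jacobian is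
`J = ∂₀φ₁∂₁φ₂ − ∂₁φ₁∂₀φ₂ = s · (∂₁c)(w₀, w₁, ϖ)`, so `[h∘Φ_s · J]_{s=0}^{s=1}` is exactly the fold
element. Corollary `foldInstance_mem_relations`: the census instance `c₀ = w₁(1−w₁)(1+2w₁)`,
`h = −1/(1 + ϖ y₀(1−y₀) y₁)`, i.e. `P/Q = (6w₁² − 2w₁ − 1)/(1 + ϖ w₀(1−w₀) c₀)`, `ϖ₀ ≥ 0`.
What is NOT here: the general descent of the crux (fibres of arbitrary vanishing families).
References: Kontsevich–Zagier 2001 §1.2 rules (2), (3); Ayoub, EMS Newsl. 91 (2014) Def. 10.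
-/

noncomputable section

open MeasureTheory Set MvPolynomial
open Literature.NumberTheory.Transcendental

namespace Summit.KontsevichZagierPeriods.InverseLandau.TateFamilyKernel.Descent

namespace Fold

/-! ### The re-indexing `(w₀, w₁, ϖ) ↦ (w₀, w₁, s, ϖ)` = `![0, 1, 3]` and the isotopy `Φ_s` -/

/-- The re-indexing `![0, 1, 3] : Fin 3 → Fin 4` (`w₀ ↦ w₀`, `w₁ ↦ w₁`, `ϖ ↦ ϖ`, skipping the
isotopy parameter `s = X 2`) is injective. [folklore] -/
theorem injective_reindex : Function.Injective (![0, 1, 3] : Fin (2 + 1) → Fin (2 + 1 + 1)) := by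
  decide

/-- Evaluating a re-indexed polynomial at the double slice `(z, s, ϖ₀)` forgets `s`:
`(rename ![0,1,3] P)(z₀, z₁, s, ϖ₀) = P(z₀, z₁, ϖ₀)`. [folklore] -/
theorem aeval_rename_reindex (ϖ₀ : ℝ) (z : Fin 2 → ℝ) (s : ℝ) (P : MvPolynomial (Fin (2 + 1)) ℚ) :
    aeval (Fin.snoc (Fin.snoc z s : Fin (2 + 1) → ℝ) ϖ₀ : Fin (2 + 1 + 1) → ℝ)
        (rename (![0, 1, 3] : Fin (2 + 1) → Fin (2 + 1 + 1)) P) =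
      aeval (Fin.snoc z ϖ₀ : Fin (2 + 1) → ℝ) P := by
  have h : (Fin.snoc (Fin.snoc z s : Fin (2 + 1) → ℝ) ϖ₀ : Fin (2 + 1 + 1) → ℝ) ∘
      (![0, 1, 3] : Fin (2 + 1) → Fin (2 + 1 + 1)) = (Fin.snoc z ϖ₀ : Fin (2 + 1) → ℝ) := by
    funext j
    fin_cases j <;> rfl
  rw [aeval_rename, h]

/-- The Jacobian of the straight-line isotopy `Φ_s = (w₀, s·c(w₀, w₁, ϖ))`:
`∂₀φ₁∂₁φ₂ − ∂₁φ₁∂₀φ₂ = s · (∂₁ c)(w₀, w₁, ϖ)`. [folklore] -/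
theorem jacobian (c : MvPolynomial (Fin (2 + 1)) ℚ) :
    pderiv 0 (X 0 : MvPolynomial (Fin (2 + 1 + 1)) ℚ) *
          pderiv 1 (X 2 * rename (![0, 1, 3] : Fin (2 + 1) → Fin (2 + 1 + 1)) c) -
        pderiv 1 (X 0 : MvPolynomial (Fin (2 + 1 + 1)) ℚ) *
          pderiv 0 (X 2 * rename (![0, 1, 3] : Fin (2 + 1) → Fin (2 + 1 + 1)) c) =
      X 2 * rename (![0, 1, 3] : Fin (2 + 1) → Fin (2 + 1 + 1)) (pderiv 1 c) := by
  have h : pderiv 1 (rename (![0, 1, 3] : Fin (2 + 1) → Fin (2 + 1 + 1)) c) =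
      rename (![0, 1, 3] : Fin (2 + 1) → Fin (2 + 1 + 1)) (pderiv 1 c) :=
    pderiv_rename injective_reindex 1 c
  rw [pderiv_X_self, one_mul, pderiv_X_of_ne (show (0 : Fin (2 + 1 + 1)) ≠ 1 by decide), zero_mul,
    sub_zero, pderiv_mul, pderiv_X_of_ne (show (2 : Fin (2 + 1 + 1)) ≠ 1 by decide), zero_mul,
    zero_add, h]

/-- The value of `s · (rename ![0,1,3] P)` at the double slice `(z, s, ϖ₀)` is `s · P(z, ϖ₀)`.
[folklore] -/
theorem aeval_X_two_mul_rename (ϖ₀ : ℝ) (z : Fin 2 → ℝ) (s : ℝ)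
    (P : MvPolynomial (Fin (2 + 1)) ℚ) :
    aeval (Fin.snoc (Fin.snoc z s : Fin (2 + 1) → ℝ) ϖ₀ : Fin (2 + 1 + 1) → ℝ)
        (X 2 * rename (![0, 1, 3] : Fin (2 + 1) → Fin (2 + 1 + 1)) P) =
      s * aeval (Fin.snoc z ϖ₀ : Fin (2 + 1) → ℝ) P := by
  rw [map_mul, aeval_X, aeval_rename_reindex]
  rfl

/-- The substitution datum of the isotopy, read at the double slice `(z, s, ϖ₀)`:
`(φ₁, φ₂, ϖ)(z, s, ϖ₀) = (z₀, s·c(z, ϖ₀), ϖ₀)`. [folklore] -/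
theorem isotopy_apply (c : MvPolynomial (Fin (2 + 1)) ℚ) (ϖ₀ : ℝ) (z : Fin 2 → ℝ) (s : ℝ) :
    (fun i : Fin (2 + 1) =>
        aeval (Fin.snoc (Fin.snoc z s : Fin (2 + 1) → ℝ) ϖ₀ : Fin (2 + 1 + 1) → ℝ)
          ((![X 0, X 2 * rename (![0, 1, 3] : Fin (2 + 1) → Fin (2 + 1 + 1)) c, X 3] :
            Fin (2 + 1) → MvPolynomial (Fin (2 + 1 + 1)) ℚ) i)) =
      (Fin.snoc (![z 0, s * aeval (Fin.snoc z ϖ₀ : Fin (2 + 1) → ℝ) c] : Fin 2 → ℝ) ϖ₀ :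
        Fin (2 + 1) → ℝ) := by
  funext i
  fin_cases i
  · show aeval (Fin.snoc (Fin.snoc z s : Fin (2 + 1) → ℝ) ϖ₀ : Fin (2 + 1 + 1) → ℝ)
        (X 0 : MvPolynomial (Fin (2 + 1 + 1)) ℚ) = z 0
    exact aeval_X _ _
  · show aeval (Fin.snoc (Fin.snoc z s : Fin (2 + 1) → ℝ) ϖ₀ : Fin (2 + 1 + 1) → ℝ)
        (X 2 * rename (![0, 1, 3] : Fin (2 + 1) → Fin (2 + 1 + 1)) c) =
      s * aeval (Fin.snoc z ϖ₀ : Fin (2 + 1) → ℝ) c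
    exact aeval_X_two_mul_rename ϖ₀ z s c
  · show aeval (Fin.snoc (Fin.snoc z s : Fin (2 + 1) → ℝ) ϖ₀ : Fin (2 + 1 + 1) → ℝ)
        (X 3 : MvPolynomial (Fin (2 + 1 + 1)) ℚ) = ϖ₀
    exact aeval_X _ _

/-- Pulling back along the isotopy and double-slicing: for every `P ∈ ℚ[y₀, y₁, ϖ]`,
`(P∘Φ)(z, s, ϖ₀) = P(z₀, s·c(z, ϖ₀), ϖ₀)`. [folklore] -/
theorem aeval_bind₁_isotopy (c : MvPolynomial (Fin (2 + 1)) ℚ) (ϖ₀ : ℝ) (z : Fin 2 → ℝ) (s : ℝ)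
    (P : MvPolynomial (Fin (2 + 1)) ℚ) :
    aeval (Fin.snoc (Fin.snoc z s : Fin (2 + 1) → ℝ) ϖ₀ : Fin (2 + 1 + 1) → ℝ)
        (bind₁ ![X 0, X 2 * rename (![0, 1, 3] : Fin (2 + 1) → Fin (2 + 1 + 1)) c, X 3] P) =
      aeval (Fin.snoc (![z 0, s * aeval (Fin.snoc z ϖ₀ : Fin (2 + 1) → ℝ) c] : Fin 2 → ℝ) ϖ₀ :
        Fin (2 + 1) → ℝ) P :=
  (aeval_bind₁ _ _ _).trans
    (congrArg (fun v : Fin (2 + 1) → ℝ => aeval v P) (isotopy_apply c ϖ₀ z s))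

end Fold

open Fold in
/-- STUB `stub_foldClass` of line `Sketch` — **the FOLD class is a relation class, dimension 2.**
Data: `c ∈ ℚ[w₀, w₁, ϖ]` vanishing on both faces `w₁ = 0`, `w₁ = 1` (divisibility by `X 1` and by
`1 - X 1`), a rational `h = B/E ∈ ℚ(y₀, y₁, ϖ)`, and a real-algebraic `ϖ₀` with
`E(w₀, s·c(w, ϖ₀), ϖ₀) ≠ 0` for `(w, s) ∈ [0,1]² × [0,1]`. Conclusion: every tame cube
representation of the fold element `h(w₀, c(w, ϖ₀), ϖ₀) · (∂_{w₁} c)(w, ϖ₀)` — the pull-back of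
`h dy₀ dy₁` under the degree-`0` face-compatible map `Φ(w) = (w₀, c(w))` — is a relation.
Proof: the straight-line family `Φ_s = (w₀, s·c(w))` is a face-compatible polynomial isotopy from a
map with zero Jacobian to `Φ`, with Jacobian `s·∂₁c` (`Fold.jacobian`); apply `stub_isotopyTwo`
with `φ₁ = X 0`, `φ₂ = X 2 * rename ![0,1,3] c`, `c₁₀ = 0`, `c₁₁ = 1`, `c₂₀ = c₂₁ = 0`.
[cite: KontsevichZagier2001, §1.2 rules (2), (3)] [cite: Ayoub2014, Def. 10] -/
theorem stub_foldClass (c B E : MvPolynomial (Fin (2 + 1)) ℚ)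
    (hc0 : ∃ R : MvPolynomial (Fin (2 + 1)) ℚ, c = X 1 * R)
    (hc1 : ∃ R : MvPolynomial (Fin (2 + 1)) ℚ, c = (1 - X 1) * R)
    (ϖ₀ : ℝ) (halg : IsAlgebraic ℚ ϖ₀)
    (hE : ∀ w ∈ KZ.cube 2, ∀ s ∈ Icc (0 : ℝ) 1,
      aeval (Fin.snoc (![w 0, s * aeval (Fin.snoc w ϖ₀ : Fin (2 + 1) → ℝ) c] : Fin 2 → ℝ) ϖ₀ :
        Fin (2 + 1) → ℝ) E ≠ 0) :
    ∀ R : KZ.IntegralRep 2, R.IsTameCube →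
      (∀ w ∈ KZ.cube 2, R.integrand w =
        aeval (Fin.snoc (![w 0, aeval (Fin.snoc w ϖ₀ : Fin (2 + 1) → ℝ) c] : Fin 2 → ℝ) ϖ₀ :
            Fin (2 + 1) → ℝ) B /
          aeval (Fin.snoc (![w 0, aeval (Fin.snoc w ϖ₀ : Fin (2 + 1) → ℝ) c] : Fin 2 → ℝ) ϖ₀ :
            Fin (2 + 1) → ℝ) E *
          aeval (Fin.snoc w ϖ₀ : Fin (2 + 1) → ℝ) (pderiv 1 c)) →
      KZ.of R ∈ KZ.relations := by
  intro R hR hRi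
  obtain ⟨R₀, hR₀⟩ := hc0
  obtain ⟨R₁, hR₁⟩ := hc1
  refine stub_isotopyTwo (X 0) (X 2 * rename (![0, 1, 3] : Fin (2 + 1) → Fin (2 + 1 + 1)) c) B E
    0 1 0 0 ⟨1, by rw [C_0, zero_add, mul_one]⟩ ⟨-1, by rw [C_1]; ring⟩
    ⟨X 2 * rename (![0, 1, 3] : Fin (2 + 1) → Fin (2 + 1 + 1)) R₀, ?_⟩
    ⟨X 2 * rename (![0, 1, 3] : Fin (2 + 1) → Fin (2 + 1 + 1)) R₁, ?_⟩ ϖ₀ halg ?_ R hR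
    fun z hz => ?_
  · -- the face `w₁ = 0` goes to the edge `y₁ = 0`
    rw [hR₀, map_mul, rename_X, C_0, zero_add]
    show X 2 * (X 1 * rename (![0, 1, 3] : Fin (2 + 1) → Fin (2 + 1 + 1)) R₀) = _
    ring
  · -- the face `w₁ = 1` goes to the edge `y₁ = 0`
    rw [hR₁, map_mul, map_sub, map_one, rename_X, C_0, zero_add]
    show X 2 * ((1 - X 1) * rename (![0, 1, 3] : Fin (2 + 1) → Fin (2 + 1 + 1)) R₁) = _
    ring
  · -- `E∘Φ_s ≠ 0` on the closed cube `[0,1]³`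
    intro w hw
    rw [← Fin.snoc_init_self (q := w)] at hw ⊢
    obtain ⟨hz, hs0, hs1⟩ := KZ.snoc_mem_cube_iff.1 hw
    rw [aeval_bind₁_isotopy]
    exact hE _ hz _ ⟨hs0, hs1⟩
  · -- the integrand is `[h∘Φ_s · J_s]_{s=0}^{s=1}`
    rw [hRi z hz]
    simp only [aeval_bind₁_isotopy, jacobian, aeval_X_two_mul_rename, one_mul, zero_mul, mul_zero,
      sub_zero]

namespace Fold

/-! ### The census instance `c₀ = w₁(1−w₁)(1+2w₁)`, `h = −1/(1 + ϖ y₀(1−y₀) y₁)` -/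

/-- Value of the fold map `c₀ = w₁(1−w₁)(1+2w₁)`. [folklore] -/
theorem eval_c₀ (v : Fin (2 + 1) → ℝ) :
    aeval v ((X 1 * (1 - X 1) * (1 + C 2 * X 1)) : MvPolynomial (Fin (2 + 1)) ℚ) =
      v 1 * (1 - v 1) * (1 + 2 * v 1) := by
  simp

/-- Value of `∂₁c₀ = 1 + 2w₁ − 6w₁²`. [folklore] -/
theorem eval_pderiv_c₀ (v : Fin (2 + 1) → ℝ) :
    aeval v (pderiv 1 ((X 1 * (1 - X 1) * (1 + C 2 * X 1)) : MvPolynomial (Fin (2 + 1)) ℚ)) =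
      1 + 2 * v 1 - 6 * v 1 ^ 2 := by
  simp [Derivation.leibniz, smul_eq_mul, -mul_eq_mul_left_iff, -mul_eq_mul_right_iff]
  ring

/-- Value of the denominator `E = 1 + ϖ y₀(1−y₀) y₁` of `h`. [folklore] -/
theorem eval_E₀ (v : Fin (2 + 1) → ℝ) :
    aeval v ((1 + X 2 * (X 0 * (1 - X 0)) * X 1) : MvPolynomial (Fin (2 + 1)) ℚ) =
      1 + v 2 * (v 0 * (1 - v 0)) * v 1 := by
  simp

/-- [folklore] -/
theorem snoc_vec2_0 (a b t : ℝ) : (Fin.snoc (![a, b] : Fin 2 → ℝ) t : Fin (2 + 1) → ℝ) 0 = a := rfl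
/-- [folklore] -/
theorem snoc_vec2_1 (a b t : ℝ) : (Fin.snoc (![a, b] : Fin 2 → ℝ) t : Fin (2 + 1) → ℝ) 1 = b := rfl
/-- [folklore] -/
theorem snoc_vec2_2 (a b t : ℝ) : (Fin.snoc (![a, b] : Fin 2 → ℝ) t : Fin (2 + 1) → ℝ) 2 = t := rfl

/-- `c₀(b) = b(1−b)(1+2b) ≥ 0` on `[0,1]`. [folklore] -/
theorem c₀_nonneg {b : ℝ} (hb : 0 ≤ b ∧ b ≤ 1) : 0 ≤ b * (1 - b) * (1 + 2 * b) :=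
  mul_nonneg (mul_nonneg hb.1 (sub_nonneg.2 hb.2)) (by linarith)

/-- `1 + ϖ₀ a(1−a) t > 0` for `ϖ₀ ≥ 0`, `a ∈ [0,1]`, `t ≥ 0`: no wall for `ϖ₀ ≥ 0`. [folklore] -/
theorem E₀_pos {ϖ₀ a t : ℝ} (hϖ : 0 ≤ ϖ₀) (ha : 0 ≤ a ∧ a ≤ 1) (ht : 0 ≤ t) :
    0 < 1 + ϖ₀ * (a * (1 - a)) * t := by
  have : 0 ≤ ϖ₀ * (a * (1 - a)) * t :=
    mul_nonneg (mul_nonneg hϖ (mul_nonneg ha.1 (sub_nonneg.2 ha.2))) ht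
  linarith

end Fold

open Fold in
/-- **The census instance of the fold class** (family `bd-z2only`, the "dark candidate": vanishing
open-square integrals, irreducible symmetry-free denominator, NOT Griffiths-exact in the square
variables). With `c₀ = w₁(1−w₁)(1+2w₁)`, `Q = 1 + ϖ w₀(1−w₀) c₀(w₁)` and
`P = 6w₁² − 2w₁ − 1 = −∂₁c₀`, every tame cube representation of `P/Q(w, ϖ₀)`, `ϖ₀ ≥ 0` real
algebraic, is a KZ relation: it is the fold element of `c = c₀`, `h = −1/(1 + ϖ y₀(1−y₀) y₁)`
(`stub_foldClass`; the denominator is `≥ 1` on the closed cube).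
[cite: KontsevichZagier2001, §1.2 rules (2), (3)] [cite: Ayoub2014, Def. 10] -/
theorem foldInstance_mem_relations (ϖ₀ : ℝ) (halg : IsAlgebraic ℚ ϖ₀) (hϖ : 0 ≤ ϖ₀) :
    ∀ R : KZ.IntegralRep 2, R.IsTameCube →
      (∀ w ∈ KZ.cube 2, R.integrand w =
        (6 * w 1 ^ 2 - 2 * w 1 - 1) /
          (1 + ϖ₀ * (w 0 * (1 - w 0)) * (w 1 * (1 - w 1) * (1 + 2 * w 1)))) →
      KZ.of R ∈ KZ.relations := by
  intro R hR hRi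
  refine stub_foldClass (X 1 * (1 - X 1) * (1 + C 2 * X 1)) (-1)
    (1 + X 2 * (X 0 * (1 - X 0)) * X 1) ⟨(1 - X 1) * (1 + C 2 * X 1), by ring⟩
    ⟨X 1 * (1 + C 2 * X 1), by ring⟩ ϖ₀ halg (fun w hw s hs => ?_) R hR fun w hw => ?_
  · -- no wall: `E(w₀, s c₀, ϖ₀) ≥ 1`
    rw [eval_E₀, snoc_vec2_0, snoc_vec2_1, snoc_vec2_2, eval_c₀, Gap.snoc3_1]
    exact (E₀_pos hϖ (KZ.mem_cube.1 hw 0) (mul_nonneg hs.1 (c₀_nonneg (KZ.mem_cube.1 hw 1)))).ne'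
  · -- `P/Q = h(w₀, c₀, ϖ₀) · ∂₁c₀`
    rw [hRi w hw, map_neg, map_one, eval_E₀, snoc_vec2_0, snoc_vec2_1, snoc_vec2_2, eval_c₀,
      eval_pderiv_c₀, Gap.snoc3_1]
    ring

end Summit.KontsevichZagierPeriods.InverseLandau.TateFamilyKernel.Descent
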